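import Literature.NumberTheory.GaloisRepresentations.IdeleTruncatedSUnitsSequence
import Literature.NumberTheory.GaloisRepresentations.IdeleClassBarSLayerKernel
import Literature.NumberTheory.GaloisRepresentations.RestrictedRamificationCapitulationLayer
import HarnessLib

/-!
# Harari's sequence `0 → E_S → I_S → C_S → 0` (17.1) in `C_{G_S}`, II: exactness at `I_S`, surjectivity of
# `I_S → C̄_S` (capitulation in `K_S`), and `ShortExact` (Harari §17.4, Lemma 15.39; NSW (8.3.11))

Topic `NumberTheory/GaloisRepresentations`; namespace `Literature.NumberTheory.GaloisRepresentations.IdeleClassBar`.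
THEOREMS ONLY (no definition, no named fact, no instance, no notation, no `sorry`); number fields in `Type`.  Sequel to
`IdeleTruncatedSUnitsSequence.lean` (`truncSeqS K S : E_S → I_S → C̄_S`, `mono_truncSeqS_f`), -w3 g17's
`IdeleClassBarSLayerKernel.lean` (`ofLayerS_eq_zero_iff`: the kernel of `C_E → C̄_S` is EXACTLY `U_{E,S}`) and -w6 g8's
`RestrictedRamificationCapitulationLayer.lean` (`exists_capitulationGalLayer`: every layer `E ⊂ K_S` has a layer
`M ⊇ E` inside `K_S` in which every idèle of `E` is principal × `S`-idèle — the principal ideal theorem).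

THE MATHEMATICS (Harari, *Galois Cohomology and CFT*, Lemma 15.39 and §17.4 (17.1); NSW VIII §3, proof of (8.3.11)).
* **Exactness at `I_S`** (`exists_sUnitsToTruncD_eq_of_truncToClassBarSD_eq_zero`): if `[x]_E ∈ I_S` (`x ∈ J_{E,S}`,
  `E ⊂ K_S`) dies in `C̄_S`, then `[x] ∈ im(U_{E,S} → C_E)` (kernel of `C_E → C̄_S`), so `x = u · (a)` with `u ∈ U_{E,S}`,
  `a ∈ Eˣ`; as `(a) = u⁻¹ x` has unit components off `S`, `a` is an `S`-UNIT, and truncating, `x = (a)^{(S)}` is the image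
  of `[a]_E ∈ E_S`.  (Harari: "`J_{F,S} ∩ F^* U_{F,S} = i(𝒪_{F,S}^*)`".)
* **Surjectivity of `I_S → C̄_S`** (`truncToClassBarSD_surjective`): a class `ofLayerS [y]`, `y ∈ J_E`, is read in a
  capitulating layer `M ⊇ E` inside `K_S`, where `y_M = (u) · j` with `j ∈ J_{M,S}^{Tate} = J_{M,S} · U_{M,S}`
  (`truncIdeles_sup_unitIdelesOff`), `j = t · v`; modulo `Mˣ · U_{M,S}` the class of `y_M` is that of the TRUNCATED idèle
  `t`, i.e. the image of `[t]_M ∈ I_S`.  (At a fixed layer the cokernel is `Cl_{F,S}` — Harari Lemma 15.39 —; it dies in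
  `K_S` by the principal ideal theorem, NSW (8.3.11).)
* Hence **`truncSeqS_shortExact : (truncSeqS K S).ShortExact`** in `DiscreteRepCat ℤ G_S` — the short exact sequence
  `T_S` of the `P`-class formation `(G_S, C̄_S)` that Milne's `Ext` road (I §4, proof of Thm. 4.10) applies `Ext_{G_S}(M^D, –)` to.

Cell bsd-eis, lane «PT-Ш-S-TC», brick D3/D4b step F2e (seat bsd-line-x1-p1-w6 gen 11).  HONEST FRAMING: bookkeeping of
classical objects over landed theorems (principal ideal theorem, `S`-unit criterion); no duality theorem and no case of
BSD is proved here.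

## References
* D. Harari, *Galois Cohomology and Class Field Theory*, Universitext, Springer (2020), Def. 15.38, Lemma 15.39 (proof),
  §17.4 (17.1). [Harari2020]
* J. Neukirch, A. Schmidt, K. Wingberg, *Cohomology of Number Fields*, 2nd ed. (2008), VIII §3 (8.3.8)–(8.3.11).
  [NeukirchSchmidtWingberg2008]
* J. Neukirch, *Algebraic Number Theory* (1999), Ch. VI §7 Thm. (7.5) (principal ideal theorem). [NeukirchANT1999]
-/

noncomputable section

open NumberField IsDedekindDomain CategoryTheory
open Field (absoluteGaloisGroup)
open Literature.NumberTheory.Automorphic Literature.Algebra.Homology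
open Literature.NumberTheory.GaloisRepresentations.LocalWeilDatum (galFixing)
open scoped Classical

universe u

namespace Literature.NumberTheory.GaloisRepresentations

/-- Exactness of a short complex of representations is exactness of the underlying modules (reflected by the faithful
forgetful functor; universe-polymorphic so that `forget₂` is elaborated once, as in `GalLayerSystemHom`). [folklore] -/
private theorem repShortComplex_exact_of_apply' {k G : Type u} [CommRing k] [Group G] (T : ShortComplex (Rep.{u} k G))
    (hex : ∀ x, T.g.hom x = 0 → ∃ y, T.f.hom y = x) : T.Exact := by
  apply (forget₂ (Rep k G) (ModuleCat k)).reflects_exact_of_faithful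
  rw [ShortComplex.moduleCat_exact_iff]
  exact hex

/-- Group bookkeeping for the capitulation step: if `y = p · (t · v)` with `p ∈ N`, then `[v⁻¹] = [t] / [y]` in `G ⧸ N`.
[folklore] -/
private theorem mk_inv_eq_mk_div_mk_of_eq {G : Type*} [CommGroup G] (N : Subgroup G) [N.Normal] {p t v y : G}
    (hp : p ∈ N) (hy : y = p * (t * v)) : ((v⁻¹ : G) : G ⧸ N) = (t : G ⧸ N) / (y : G ⧸ N) := by
  have h1 : (y : G ⧸ N) = (t : G ⧸ N) * (v : G ⧸ N) := by
    rw [hy, QuotientGroup.mk_mul, QuotientGroup.mk_mul, (QuotientGroup.eq_one_iff p).2 hp, one_mul]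
  rw [h1, QuotientGroup.mk_inv, div_mul_eq_div_div, div_self', one_div]

namespace IdeleClassBar

open IdeleCohomology SUnits DiscreteGaloisModule

variable {K : Type} [Field K] [NumberField K] {S : Finset (HeightOneSpectrum (𝓞 K))}

/-! ## §1. Exactness at `I_S`: `ker (I_S → C̄_S) = im (E_S → I_S)` -/

/-- **An element of `I_S` dying in `C̄_S` is the truncated principal idèle of an `S`-unit** (Harari:
`J_{F,S} ∩ F^* U_{F,S} = i(𝒪_{F,S}^*)`, read in the limit over `F ⊂ K_S` through -w3 g17's layer-kernel theorem).
[cite: Harari2020, Lemma 15.39 (proof), §17.4 (17.1)] [cite: NeukirchSchmidtWingberg2008, VIII §3 (8.3.8)–(8.3.9)] -/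
theorem exists_sUnitsToTruncD_eq_of_truncToClassBarSD_eq_zero (z : (truncIdeleBarD K S).obj.V)
    (hz : (truncToClassBarSD K S).hom.hom z = 0) : ∃ w, (sUnitsToTruncD K S).hom.hom w = z := by
  obtain ⟨E, hE, x, hx, hxz⟩ := mem_truncIdeleBar_iff.1 z.2
  haveI := E.numberField
  have hE' : ramificationSubgroup K (↑S : Set (HeightOneSpectrum (𝓞 K))) ≤ galFixing K E.1 := by
    rw [galFixing_eq_coe_openNormalSubgroup]; exact hE
  have hz' : z = ⟨(ideleData K).toSystem.of E x, of_mem_truncIdeleBar E hE hx⟩ := Subtype.ext hxz.symm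
  rw [hz', truncToClassBarSD_of hE'] at hz
  obtain ⟨u, hu⟩ := (ofLayerS_eq_zero_iff S hE' _).1 hz
  set w₀ : IdeleHerbrand.unitIdelesOff K E.1 S := Additive.toMul u with hw₀
  -- equal classes: `x = w₀ · (a)` for some `a ∈ Eˣ`
  have hux : (w₀ : ideleGroup E.1)⁻¹ * (Additive.toMul x : ideleGroup E.1) ∈ principalIdeles E.1 := by
    rw [← QuotientGroup.eq]
    exact congrArg Additive.toMul hu
  obtain ⟨a, ha⟩ := hux
  have ha' : IdeleHerbrand.principal E.1 a = (w₀ : ideleGroup E.1)⁻¹ * (Additive.toMul x : ideleGroup E.1) := ha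
  -- `a` is an `S`-unit and `(a)^{(S)} = x`
  have haS : IdeleHerbrand.principal E.1 a ∈ ideleS K E.1 S := by
    rw [ha']
    exact (ideleS K E.1 S).mul_mem ((ideleS K E.1 S).inv_mem (IdeleHerbrand.unitIdelesOff_le_ideleS w₀.2))
      (IdeleHerbrand.truncIdeles_le_ideleS hx)
  have hsu : a ∈ sUnits K (↑S : Set (HeightOneSpectrum (𝓞 K))) E.1 := (principal_mem_ideleS_iff_mem_sUnits' a).1 haS
  have hw₁ : IdeleHerbrand.truncOf S ((w₀ : ideleGroup E.1)⁻¹) = 1 :=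
    IdeleHerbrand.truncOf_eq_one_of_mem_unitIdelesOff S ((IdeleHerbrand.unitIdelesOff K E.1 S).inv_mem w₀.2)
  have htrunc : IdeleHerbrand.truncOf S (IdeleHerbrand.principal E.1 a) = Additive.toMul x := by
    rw [ha', IdeleHerbrand.truncOf_mul, hw₁, one_mul]
    exact IdeleHerbrand.truncOf_eq_self S hx
  -- the `S`-unit `a` as an element of `E_S`
  have hmemS : unitsBarAddEquiv K ((unitsData K).toSystem.of E (Additive.ofMul a)) ∈
      sUnitsSubmodule K (↑S : Set (HeightOneSpectrum (𝓞 K))) := by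
    rw [mem_sUnitsSubmodule_iff, toAdditive_unitsBarAddEquiv, unitsBarToUnits_of]
    exact map_mem_sUnits (K := K) (S := (↑S : Set (HeightOneSpectrum (𝓞 K)))) E.1.val hsu
  have hinv : ∀ g : ramificationSubgroup K (↑S : Set (HeightOneSpectrum (𝓞 K))),
      ((sUnitsModule K (↑S : Set (HeightOneSpectrum (𝓞 K)))).toRepresentation.comp
        (ramificationSubgroup K (↑S : Set (HeightOneSpectrum (𝓞 K)))).subtype) g ⟨_, hmemS⟩ = ⟨_, hmemS⟩ := fun g => by
    apply Subtype.ext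
    change units K g.1 (unitsBarAddEquiv K ((unitsData K).toSystem.of E (Additive.ofMul a))) =
      unitsBarAddEquiv K ((unitsData K).toSystem.of E (Additive.ofMul a))
    rw [← unitsBarAddEquiv_rep, (unitsData K).toSystem.rep_of_of_mem E (hE g.2)]
  refine ⟨⟨⟨_, hmemS⟩, hinv⟩, Subtype.ext ?_⟩
  rw [coe_sUnitsToTruncD_of (E := E) a, htrunc, hz']
  · rfl
  · rw [coe_sUnitsToUnitsKS_apply]
    exact ((unitsBarAddEquiv K).symm_apply_apply _).symm

/-! ## §2. Surjectivity of `I_S → C̄_S` (in the limit over `K_S`, by capitulation) -/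

/-- **`I_S → C̄_S` is surjective**: every class of `C̄_S = lim→_{F ⊂ K_S} C_S(F)` is the class of a TRUNCATED idèle of a
capitulating layer (principal ideal theorem inside `K_S` + `J_{M,S}^{Tate} = J_{M,S} · U_{M,S}`).
[cite: Harari2020, Lemma 15.39, §17.4 (17.1)] [cite: NeukirchSchmidtWingberg2008, VIII §3 (proof of (8.3.11))]
[cite: NeukirchANT1999, Ch. VI §7 Thm. (7.5)] -/
theorem truncToClassBarSD_surjective : Function.Surjective (truncToClassBarSD K S).hom.hom := fun c => by
  obtain ⟨E, hE, xc, rfl⟩ := exists_ofLayerS S c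
  haveI := E.numberField
  obtain ⟨y, rfl⟩ := ideleToClass_surjective K E xc
  have hE₀ : ramificationSubgroup K (↑S : Set (HeightOneSpectrum (𝓞 K))) ≤ E.1.fixingSubgroup := fun σ hσ =>
    (mem_galFixing_iff_mem_fixingSubgroup E σ).1 (hE hσ)
  obtain ⟨M, h, hM, -, hcap⟩ := exists_capitulationGalLayer (S := (↑S : Set (HeightOneSpectrum (𝓞 K)))) E hE₀
  haveI := M.numberField
  letI := GalLayer.algebraOfLE h
  obtain ⟨u, j, hj, hyj⟩ := hcap K S (Additive.toMul y)
  -- split the Tate `S`-idèle `j` as truncated × unit-off-`S`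
  rw [← IdeleHerbrand.truncIdeles_sup_unitIdelesOff] at hj
  obtain ⟨t, ht, v, hv, rfl⟩ := Subgroup.mem_sup.1 hj
  have hM' : ramificationSubgroup K (↑S : Set (HeightOneSpectrum (𝓞 K))) ≤ galFixing K M.1 := fun σ hσ =>
    (mem_galFixing_iff_mem_fixingSubgroup M σ).2 (hM hσ)
  have hMo : ramificationSubgroup K (↑S : Set (HeightOneSpectrum (𝓞 K))) ≤
      (M.openNormalSubgroup : Subgroup (absoluteGaloisGroup K)) := by
    rw [← galFixing_eq_coe_openNormalSubgroup]; exact hM'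
  -- the truncated idèle `t` as a vector of the layer `M`
  obtain ⟨xt, hxt⟩ : ∃ xt : (ideleData K).V M, (Additive.toMul xt : ideleGroup M.1) = t := ⟨Additive.ofMul t, rfl⟩
  have hxt' : (Additive.toMul xt : ideleGroup M.1) ∈ IdeleHerbrand.truncIdeles K M.1 S := by rw [hxt]; exact ht
  refine ⟨⟨(ideleData K).toSystem.of M xt, of_mem_truncIdeleBar M hMo hxt'⟩, ?_⟩
  rw [truncToClassBarSD_of hM', ← ofLayerS_transHom S h hE hM']
  -- the base change of the class of `y` is the class of `y_M = (u) · t · v`; modulo `U_{M,S}` it is the class of `t`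
  have hbase : transHom E M h ((ideleToClass K).app E y) = (ideleToClass K).app M ((ideleData K).base h y) :=
    (ideleToClass K).base_app h y
  rw [hbase]
  refine (ofLayerS_eq_ofLayerS_iff S hM' _ _).2
    ⟨Additive.ofMul (α := ↥(IdeleHerbrand.unitIdelesOff K M.1 S)) (Subtype.mk v hv)⁻¹, ?_⟩
  apply (Additive.toMul (α := IdeleClassGroup M.1)).injective
  change (((v⁻¹ : ideleGroup M.1)) : ideleGroup M.1 ⧸ principalIdeles M.1) =
    ((Additive.toMul xt : ideleGroup M.1) : ideleGroup M.1 ⧸ principalIdeles M.1) /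
      ((AdeleRing.ideleBaseChange E.1 M.1 (Additive.toMul y) : ideleGroup M.1) : ideleGroup M.1 ⧸ principalIdeles M.1)
  exact mk_inv_eq_mk_div_mk_of_eq (principalIdeles M.1) ⟨u, rfl⟩ (by rw [hxt]; exact hyj)

/-! ## §3. `0 → E_S → I_S → C̄_S → 0` is short exact in `C_{G_S}` -/

/-- **`I_S → C̄_S` is an epimorphism in `C_{G_S}`.** [cite: Harari2020, §17.4 (17.1)] -/
theorem epi_truncSeqS_g : Epi (truncSeqS K S).g :=
  (DiscreteRep.ι ℤ (GaloisGroupUnramifiedOutside K (↑S : Set (HeightOneSpectrum (𝓞 K))))).epi_of_epi_map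
    ((Rep.epi_iff_surjective (truncToClassBarSD K S).hom).2 truncToClassBarSD_surjective)

/-- **`E_S → I_S → C̄_S` is exact at `I_S`.** [cite: Harari2020, Lemma 15.39, §17.4 (17.1)] -/
theorem truncSeqS_exact : (truncSeqS K S).Exact := by
  haveI : (DiscreteRep.ι ℤ (GaloisGroupUnramifiedOutside K (↑S : Set (HeightOneSpectrum (𝓞 K))))).PreservesHomology :=
    ⟨fun _ _ f => (DiscreteRep.isDiscrete ℤ (GaloisGroupUnramifiedOutside K (↑S : Set (HeightOneSpectrum (𝓞 K))))).preservesKernels_ι f,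
      fun _ _ f => (DiscreteRep.isDiscrete ℤ (GaloisGroupUnramifiedOutside K (↑S : Set (HeightOneSpectrum (𝓞 K))))).preservesCokernels_ι f⟩
  rw [← ShortComplex.exact_map_iff_of_faithful _
    (DiscreteRep.ι ℤ (GaloisGroupUnramifiedOutside K (↑S : Set (HeightOneSpectrum (𝓞 K)))))]
  exact repShortComplex_exact_of_apply' _ fun z hz => exists_sUnitsToTruncD_eq_of_truncToClassBarSD_eq_zero z hz

/-- **Harari's (17.1): `0 → E_S → I_S → C̄_S → 0` is SHORT EXACT in `C_{G_S} = DiscreteRepCat ℤ G_S`** — with `E_S` the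
`S`-units of `K_S`, `I_S` the truncated idèles and `C̄_S = lim→ C_S(F)` the module of the `P`-class formation `(G_S, C̄_S)`.
[cite: Harari2020, §17.4 (17.1)] [cite: NeukirchSchmidtWingberg2008, VIII §3 (8.3.8)–(8.3.11)] [cite: MilneADT2006, I §4 (p. 55)] -/
theorem truncSeqS_shortExact : (truncSeqS K S).ShortExact :=
  haveI := mono_truncSeqS_f (K := K) (S := S)
  haveI := epi_truncSeqS_g (K := K) (S := S)
  { exact := truncSeqS_exact }

end IdeleClassBar

end Literature.NumberTheory.GaloisRepresentations

end
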